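import Summits.HodgeConjecture.HodgeConjecture.Theses.TorelliForSymmetries
import Literature.AlgebraicGeometry.Motives.SegreEmbedding

/-!
# Birth skeleton (BC3) of the crux `InvolutionsAreCorrespondences` (stmt-HodgeConjecture-11023),
# route `TorelliForSymmetries` — line `birth`: "double, reflect, decide"

The crux (the route's former target, auto-crux since rev 6): for every comparison-compatible
Betti–Hodge datum `B` satisfying the Künneth–Hodge clause, every smooth projective `X/ℂ` of
dimension `n`, every degree `i` and every INVOLUTIVE endomorphism `φ` of the `B`-Hodge structure
`Hⁱ_B(X)`, some rational algebraic class `u ∈ Aⁿ(X × X) ⊗ ℚ` induces `φ` (Kleiman's pairing form).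

## The line (the route's own glue `InvolutionsOfMiddle`, stmt-HodgeConjecture-14419, now kernel-checked)

DOUBLE: the Künneth–Hodge clause hands us a Hodge class `u ∈ Hdgⁿ_B(X × X)` inducing `φ`; it is a
MIDDLE-degree Hodge class on the EVEN-dimensional smooth projective `X × X`
(`IsSmoothProjective.tensor_holds`, proved in `Motives/SegreEmbedding`).  REFLECT: for a
polarization `P` of `H²ⁿ_B(X × X)` (`B.polarizable`) and any Hodge class `v` there, the
`P`-reflection `s_v = id - P(·,v)·(2/P(v,v))·v` is an involutive endomorphism of the `B`-Hodge
structure (`reflectionHom`, `exists_reflection_hom` — PROVED below from the first Hodge–Riemann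
relation `Polarization.form_apply_eq_zero`; identity in the junk case `P(v,v) = 0`), so STUB 2
(`MiddleInvolutions` at `Y = X × X`) makes every `s_v` a correspondence on `(X × X) × (X × X)`.
DECIDE: STUB 1 (`ReflectionsDecide` at `(B, X × X, p = n, P)`) turns this into
`B.HodgeConjectureFor hXX n`, i.e. `Hdgⁿ_B(X × X) = ℚ·Aⁿ_B(X × X) ∋ u`, and
`ℚ·Aⁿ ⊆ Aⁿ ⊗ ℚ` (`algebraicClasses_le_ratAlgebraicClasses`, proved: clear denominators), so `u`
is the wanted rational algebraic class.

## Contents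

* `reflection`, `reflection_reflection`, `baseChange_reflection_apply`, `reflectionHom`,
  `exists_reflection_hom` — the reflection lemma in realization form (all PROVED, no `sorry`);
  `algebraicClasses_le_ratAlgebraicClasses` (PROVED).
* the two registered stubs (`sorry` ONLY there): `stub_reflectionsDecide : ReflectionsDecide`
  (route support item 11028, provable now, M) and `stub_middleInvolutions : MiddleInvolutions`
  (route crux 14418, rank 5, HC-complete — THE load-bearing stub).
* `InvolutionsAreCorrespondences_of : ReflectionsDecide → MiddleInvolutions →
  …Theses.TorelliForSymmetries.InvolutionsAreCorrespondences` — the composition, a REAL proof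
  concluding the crux BY NAME; `InvolutionsAreCorrespondences_of_stubs` — the crux modulo exactly
  the two stubs; `involutionsOfMiddle : InvolutionsOfMiddle` — the route's glue item 14419, which
  IS the composition, hence proved here sorry-free (a prover may land it verbatim).
* `example`s (PROVED, unconditional): tightness `InvolutionsAreCorrespondences → MiddleInvolutions`
  (STUB 2 is the crux's even-dimension/middle-degree instance, so not stronger than the crux);
  HC-safety `HodgeConjecture → InvolutionsAreCorrespondences` and `HodgeConjecture →
  MiddleInvolutions` (via `IsComparisonCompatible.bettiHodgeConjectureFor`): neither the crux nor
  a stub is refutable short of `¬HC`; BC5 special cases of the crux's conclusion —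
  `isCorrespondence_of_eq_pullback` (Hodge endomorphisms induced by an endomorphism `g : X ⟶ X`,
  in particular involutions coming from automorphisms: the "benign ⟹ correspondence" half of the
  route's two-layer plan, by the C-lite axiom `exists_isInducedBy_pullback`) and
  `isCorrespondence_id` (`φ = id`, the diagonal, `exists_isInducedBy_id`).

BC3 probes (registrar folder `bc/`, attached as evidence; the skeleton is NOT imported by any
probe, so no sorried theorem is in scope): for each stub `S ∈ {ReflectionsDecide,
MiddleInvolutions}` and each target `T ∈ {InvolutionsAreCorrespondences, _root_.HodgeConjecture}`,
`example : S → T` by `first | exact? | simpa | aesop` (payload form), by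
`first | exact? | simpa [S, T] | (unfold S T; simpa) | aesop` (BC.md form), `example (h : S) : T`
by `first | exact? | simpa using h | aesop`, and each cheap tactic alone — 24/24 FAIL; converse and
dedup probes 6/6 FAIL (`bc/probe_summary.txt`).

Disproof used: none on file — `Cruxes/InvolutionsAreCorrespondences/` had no workfile at
registration (`ledger crux ls stmt-HodgeConjecture-11023`: no `Disproof.lean`, no
`_false_without_` theorem, no landed `Negative/` lemma); `ledger negatives --problem
HodgeConjecture` (3 entries: MilnorKExponential.SymbolLift, DerivedTorelliFermat K3 exhaustion,
ELineTransport E-line connectivity) — none equal or trivially equivalent to a stub.  The line uses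
the comparison-compatibility guard `B.IsComparisonCompatible` and the Künneth–Hodge clause at
STUB 2 only (they are passed through to `MiddleInvolutions`); STUB 1 is guard-free.
-/

noncomputable section

namespace Summit.HodgeConjecture.HodgeConjecture.Cruxes.InvolutionsAreCorrespondences.Birth

open Literature.AlgebraicGeometry.Motives CategoryTheory MonoidalCategory
open scoped TensorProduct
open Summit.HodgeConjecture.HodgeConjecture.Theses.TorelliForSymmetries
  (InvolutionsAreCorrespondences ReflectionsDecide MiddleInvolutions InvolutionsOfMiddle)

universe u

section Reflection

variable {V : Type u} [AddCommGroup V] [Module ℚ V]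

/-- The `Q`-reflection in `v`: `x ↦ x - Q(x,v) · (2 / Q(v,v)) · v` — verbatim the linear map of
`ReflectionsDecide`'s hypothesis (`LinearMap.id - (Q.flip v).smulRight ((2 / Q v v) • v)`); it is
the identity in the junk case `Q(v,v) = 0` (`2 / 0 = 0`). [folklore] -/
def reflection (Q : LinearMap.BilinForm ℚ V) (v : V) : V →ₗ[ℚ] V :=
  LinearMap.id - (Q.flip v).smulRight ((2 / Q v v) • v)

@[simp]
theorem reflection_apply (Q : LinearMap.BilinForm ℚ V) (v x : V) :
    reflection Q v x = x - Q x v • ((2 / Q v v) • v) := rfl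

/-- A reflection is an involution (also in the junk case `Q(v,v) = 0`, where it is the identity). [folklore] -/
theorem reflection_reflection (Q : LinearMap.BilinForm ℚ V) (v x : V) :
    reflection Q v (reflection Q v x) = x := by
  rcases eq_or_ne (Q v v) 0 with h | h
  · simp [h]
  · set c : ℚ := 2 / Q v v with hc
    have hcq : c * Q v v = 2 := by rw [hc]; field_simp
    have h2 : ∀ y : V, reflection Q v y = y - (Q y v * c) • v := fun y => by
      rw [reflection_apply, smul_smul]
    rw [h2, h2 x]
    have h3 : Q (x - (Q x v * c) • v) v = Q x v - Q x v * c * Q v v := by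
      simp only [map_sub, map_smul, LinearMap.sub_apply, LinearMap.smul_apply, smul_eq_mul]
    rw [h3]
    have h4 : (Q x v - Q x v * c * Q v v) * c = -(Q x v * c) := by
      have : Q x v * c * Q v v = Q x v * 2 := by rw [mul_assoc, hcq]
      rw [this]; ring
    rw [h4, neg_smul, sub_neg_eq_add, sub_add_cancel]

/-- `s_v ∘ s_v = id`. [folklore] -/
theorem reflection_comp_reflection (Q : LinearMap.BilinForm ℚ V) (v : V) :
    reflection Q v ∘ₗ reflection Q v = LinearMap.id :=
  LinearMap.ext fun x => reflection_reflection Q v x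

/-- The complexified reflection: `(s_v)_ℂ x = x - Q_ℂ(x, 1 ⊗ v) · (2 / Q(v,v)) · (1 ⊗ v)`. [folklore] -/
theorem baseChange_reflection_apply (Q : LinearMap.BilinForm ℚ V) (v : V) (x : ℂ ⊗[ℚ] V) :
    (reflection Q v).baseChange ℂ x =
      x - (Q.baseChange ℂ x (HodgeStructure.ofRat v)) •
        (((2 / Q v v : ℚ) : ℂ) • HodgeStructure.ofRat v) := by
  induction x using TensorProduct.induction_on with
  | zero => simp
  | tmul a y =>
      rw [LinearMap.baseChange_tmul, reflection_apply, TensorProduct.tmul_sub,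
        HodgeStructure.ofRat_apply, LinearMap.BilinForm.baseChange_tmul]
      congr 1
      rw [TensorProduct.tmul_smul, TensorProduct.tmul_smul, mul_one, smul_smul,
        TensorProduct.smul_tmul', TensorProduct.smul_tmul', TensorProduct.smul_tmul']
      congr 1
      simp only [smul_eq_mul, mul_one, Algebra.smul_def, eq_ratCast]
      push_cast
      ring
  | add x y hx hy =>
      simp only [map_add, hx, hy, LinearMap.add_apply, add_smul]
      abel

variable {w : ℤ}

/-- **Reflections in Hodge classes are endomorphisms of the Hodge structure.** For a polarization
`Q` of the weight-`w = 2p` Hodge structure `H` and a Hodge class `v` (`1 ⊗ v ∈ Fᵖ`), the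
reflection `s_v` preserves the Hodge filtration: for `a ≤ p` the correction term lies in
`ℂ · (1 ⊗ v) ⊆ Fᵖ ⊆ Fᵃ`; for `a > p` it vanishes, because `Q_ℂ(Fᵃ, F^{w+1-a}) = 0` (first
Hodge–Riemann relation) and `1 ⊗ v ∈ Fᵖ ⊆ F^{w+1-a}`. [folklore] -/
def reflectionHom (H : HodgeStructure V w) (Q : H.Polarization) {p : ℤ} (hw : p + p = w) (v : V)
    (hv : v ∈ H.hodgeClasses p) : HodgeStructure.Hom H H where
  toLinearMap := reflection Q.form v
  map_F_le a := by
    rintro _ ⟨x, hx, rfl⟩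
    rw [baseChange_reflection_apply]
    have hvp : HodgeStructure.ofRat v ∈ H.F p := (H.mem_hodgeClasses_iff p v).1 hv
    by_cases ha : a ≤ p
    · exact sub_mem hx (Submodule.smul_mem _ _ (Submodule.smul_mem _ _ (H.antitone_F ha hvp)))
    · have h0 : Q.form.baseChange ℂ x (HodgeStructure.ofRat v) = 0 :=
        Q.form_apply_eq_zero a x hx _ (H.antitone_F (show w + 1 - a ≤ p by omega) hvp)
      rw [h0, zero_smul, sub_zero]
      exact hx

end Reflection

/-- **The reflection lemma, realization form**: for any Betti–Hodge datum `B`, smooth projective `Y`,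
`p`, polarization `P` of `H²ᵖ_B(Y)` and Hodge class `v ∈ Hdgᵖ_B(Y)`, the `P`-reflection in `v` is
(the linear map of) an INVOLUTIVE endomorphism of the `B`-Hodge structure `H²ᵖ_B(Y)`. [folklore] -/
theorem exists_reflection_hom (B : BettiHodgeData ℂ) {m : ℕ} {Y : SchemeOver ℂ}
    (hY : IsSmoothProjective m Y) (p : ℕ) (P : (B.hodge hY (2 * p)).Polarization)
    (v : B.W.obj Y (2 * p)) (hv : v ∈ (B.hodge hY (2 * p)).hodgeClasses (p : ℤ)) :
    ∃ s : HodgeStructure.Hom (B.hodge hY (2 * p)) (B.hodge hY (2 * p)),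
      s.toLinearMap = LinearMap.id - (P.form.flip v).smulRight ((2 / P.form v v) • v) ∧
      s.toLinearMap ∘ₗ s.toLinearMap = LinearMap.id :=
  ⟨reflectionHom _ P (by push_cast; ring) v hv, rfl, reflection_comp_reflection _ _⟩

/-- `ℚ · Aᵖ(X) ⊆ Aᵖ(X) ⊗ ℚ` for a Weil cohomology with `ℚ`-coefficients: the `ℚ`-span of the
algebraic lattice lies in its divisible hull (clear denominators). [folklore] -/
theorem algebraicClasses_le_ratAlgebraicClasses (W : WeilCohomology ℂ ℚ) (X : SchemeOver ℂ) (p : ℕ)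
    {x : W.obj X (2 * p)} (hx : x ∈ W.algebraicClasses X p) : x ∈ W.ratAlgebraicClasses X p := by
  induction hx using Submodule.span_induction with
  | mem x hx => exact W.algebraicLattice_le_ratAlgebraicClasses X p hx
  | zero => exact zero_mem _
  | add x y _ _ hx hy => exact add_mem hx hy
  | smul q x _ hx =>
      obtain ⟨N, hN, hNx⟩ := hx
      refine ⟨N * q.den, mul_ne_zero hN (by exact_mod_cast q.den_ne_zero), ?_⟩
      have : ((N * q.den : ℤ)) • (q • x) = q.num • (N • x) := by
        rw [← Int.cast_smul_eq_zsmul ℚ, ← Int.cast_smul_eq_zsmul ℚ q.num,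
          ← Int.cast_smul_eq_zsmul ℚ N, smul_smul, smul_smul]
        congr 1
        push_cast
        rw [mul_assoc, Rat.den_mul_eq_num]
        ring
      rw [this]
      exact AddSubgroup.zsmul_mem _ hNx _

/-! ### The two registered stubs -/

/-- STUB 1 (provable now, M) — the route's support item **`ReflectionsDecide`**
(stmt-HodgeConjecture-11028), BY NAME: for ANY `B`, `X` smooth projective of dimension `n`, `p` and
any polarization `P` of `H²ᵖ_B(X)`, if every `P`-reflection in a Hodge class is induced on `H²ᵖ`
by a class in `Aⁿ(X × X) ⊗ ℚ`, then `Hdgᵖ_B(X) = ℚ·Aᵖ_B(X)`.  Intended proof (item docstring):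
`P(v,v) > 0` on non-zero rational `(p,p)`-classes (second Hodge–Riemann relation
`Polarization.pos`, `conj (1 ⊗ v) = 1 ⊗ v`); `ηᵖ` is algebraic and non-zero for `p ≤ n`,
`H²ᵖ = 0` for `p > n`; correspondences preserve rational algebraic classes
(`map_ratAlgebraicClasses_of_isInducedBy`), so `s_v(ηᵖ) = ηᵖ - (2P(ηᵖ,v)/P(v,v))·v` is
algebraic; if `P(ηᵖ,v) ≠ 0` done, else use `v + ηᵖ`.  Why it might fail: only as a Lean-size
risk (`ηᵖ ≠ 0` needs `tr ηⁿ = deg > 0` from the Weil-cohomology fields).  Used by the composition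
at `(B, X × X, p = n)`. [cite: Kleiman1968, §1.3] [cite: VoisinHodgeI2002, §11.3.3 Lemma 11.41] -/
theorem stub_reflectionsDecide : ReflectionsDecide := by
  sorry

/-- STUB 2 (THE LOAD-BEARING STUB; open — HC-complete) — the route's catch-all crux
**`MiddleInvolutions`** (stmt-HodgeConjecture-14418, rank 5), BY NAME: for every guarded `B`,
every smooth projective `Y` of EVEN dimension `n + n` and every involutive endomorphism `φ` of the
`B`-Hodge structure on the MIDDLE cohomology `H²ⁿ_B(Y)`, some class in `A²ⁿ(Y × Y) ⊗ ℚ` induces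
`φ`.  It is the crux's instance `(dim, degree) = (n + n, 2n)` (tightness `example` below) and,
by DOUBLING + REFLECTIONS, implies the whole crux (the composition); conversely `HC(Y × Y)`
implies it (HC-safety `example` below).  Why it might fail: iff HC fails somewhere — sharpest
middle-degree candidates: Weil classes on abelian fourfolds and sixfolds read as swap involutions,
Schoen-type classes on self-products of cyclic covers, CM splittings of general-type surfaces
(item docstring).  Used by the composition at `Y = X × X`.
[cite: VoisinHodgeI2002, §11.3.3] [cite: MoonenZarhin1999] -/
theorem stub_middleInvolutions : MiddleInvolutions := by
  sorry

/-! ### The composition: stub₁ → stub₂ → the crux, by name -/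

/-- **THE LINE'S COMPOSITION** (kernel-checked, no `sorry`) = the route's glue item
`InvolutionsOfMiddle` (stmt-HodgeConjecture-14419) PROVED: `ReflectionsDecide → MiddleInvolutions →
InvolutionsAreCorrespondences`. -/
theorem InvolutionsAreCorrespondences_of :
    ReflectionsDecide → MiddleInvolutions → InvolutionsAreCorrespondences := by
  intro hR hM B hB hK n X hX i j' hj φ hφ
  have hXX : IsSmoothProjective (n + n) (X ⊗ X) := IsSmoothProjective.tensor_holds hX hX
  obtain ⟨u, hu, hind⟩ := hK hX hXX i j' hj φ
  obtain ⟨P⟩ := B.polarizable hXX (2 * n)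
  have hHC : B.HodgeConjectureFor hXX n := by
    refine hR B hXX n P ?_
    intro v hv j'' hj''
    obtain ⟨s, hs, hss⟩ := exists_reflection_hom B hXX n P v hv
    obtain ⟨w, hw, hwind⟩ := hM B hB hK hXX s hss j'' hj''
    refine ⟨w, hw, ?_⟩
    rw [← hs]
    exact hwind
  refine ⟨u, ?_, hind⟩
  have hu' : u ∈ B.W.algebraicClasses (X ⊗ X) n := by
    rw [hHC]
    exact hu
  exact algebraicClasses_le_ratAlgebraicClasses B.W (X ⊗ X) n hu'

/-- **The crux, closed modulo exactly the two registered stubs.** -/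
theorem InvolutionsAreCorrespondences_of_stubs : InvolutionsAreCorrespondences :=
  InvolutionsAreCorrespondences_of stub_reflectionsDecide stub_middleInvolutions

/-- The route's glue item `InvolutionsOfMiddle` (stmt-HodgeConjecture-14419) is exactly the
composition, hence PROVED here (sorry-free). -/
theorem involutionsOfMiddle : InvolutionsOfMiddle :=
  InvolutionsAreCorrespondences_of


/-! ### Proved sanity: tightness and HC-safety (stated as `example`s, so that the only theorems
concluding route items BY NAME are the skeleton's) -/

/-- **Tightness (PROVED)**: STUB 2 is the crux's instance at `(dim, degree) = (n + n, 2n)` — one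
line of instantiation; so `MiddleInvolutions` is not stronger than `InvolutionsAreCorrespondences`
(the cheap tactics of the converse probe do not find it, `bc/converse_dedup_probe.lean`). -/
example (h : InvolutionsAreCorrespondences) : MiddleInvolutions :=
  fun B hB hK n _Y hY φ hφ j' hj => h B hB hK hY (2 * n) j' hj φ hφ

/-- **HC-safety of the crux (PROVED)**: the summit Statement implies the crux — for a
comparison-compatible `B` the summit-layer HC gives the `B`-relative HC
(`IsComparisonCompatible.bettiHodgeConjectureFor`), so the Künneth–Hodge graph class `u` of `φ`
is `B`-algebraic, hence rationally algebraic.  (No involution hypothesis is needed: under HC every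
`B`-Hodge endomorphism is a correspondence.) -/
example (hHC : _root_.HodgeConjecture) : InvolutionsAreCorrespondences := by
  intro B hB hK n X hX i j' hj φ _
  have hXX : IsSmoothProjective (n + n) (X ⊗ X) := IsSmoothProjective.tensor_holds hX hX
  obtain ⟨u, hu, hind⟩ := hK hX hXX i j' hj φ
  have hHC' : B.HodgeConjectureFor hXX n := hB.bettiHodgeConjectureFor hXX (hHC hXX) n
  refine ⟨u, ?_, hind⟩
  have hu' : u ∈ B.W.algebraicClasses (X ⊗ X) n := by
    rw [hHC']
    exact hu
  exact algebraicClasses_le_ratAlgebraicClasses B.W (X ⊗ X) n hu'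

/-- **HC-safety of STUB 2 (PROVED)**: the summit Statement implies `MiddleInvolutions` (same
argument at `Y`, degree `2n`). -/
example (hHC : _root_.HodgeConjecture) : MiddleInvolutions := by
  intro B hB hK n Y hY φ _ j' hj
  have hYY : IsSmoothProjective ((n + n) + (n + n)) (Y ⊗ Y) := IsSmoothProjective.tensor_holds hY hY
  obtain ⟨u, hu, hind⟩ := hK hY hYY (2 * n) j' hj φ
  have hHC' : B.HodgeConjectureFor hYY (n + n) := hB.bettiHodgeConjectureFor hYY (hHC hYY) (n + n)
  refine ⟨u, ?_, hind⟩
  have hu' : u ∈ B.W.algebraicClasses (Y ⊗ Y) (n + n) := by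
    rw [hHC']
    exact hu
  exact algebraicClasses_le_ratAlgebraicClasses B.W (Y ⊗ Y) (n + n) hu'

/-! ### BC5: proved special cases of the crux's conclusion (unconditional, no `sorry`) -/

/-- **BC5 — geometric ("benign") endomorphisms are correspondences (PROVED).**  A `B`-Hodge
endomorphism of `Hⁱ_B(X)` whose linear map is the pull-back `g*` along an endomorphism
`g : X ⟶ X` — in particular the involution induced by an involutive AUTOMORPHISM of `X` — is
induced by a rational algebraic class in `Aⁿ(X × X) ⊗ ℚ` (the transposed graph of `g`; C-lite
field `exists_isInducedBy_pullback`).  This is the automorphism half of the route's glue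
"benign ⟹ correspondence"; the PHANTOM involutions (induced by no automorphism) are the content
of the stubs. [cite: Kleiman1968, §1.3] -/
theorem isCorrespondence_of_eq_pullback (B : BettiHodgeData ℂ) {n : ℕ} {X : SchemeOver ℂ}
    (hX : IsSmoothProjective n X) (g : X ⟶ X) (i j' : ℕ) (hj : i + j' = 2 * n)
    (φ : HodgeStructure.Hom (B.hodge hX i) (B.hodge hX i))
    (hφ : φ.toLinearMap = B.W.pullback g i) :
    ∃ u ∈ B.W.ratAlgebraicClasses (X ⊗ X) n,
      B.W.IsInducedBy n n u φ.toLinearMap hj (show i + 2 * n + j' = 2 * (n + n) by omega) := by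
  obtain ⟨u, hu, h⟩ := B.W.exists_isInducedBy_pullback hX hX g
  exact ⟨u, hu, hφ ▸ h i j' hj⟩

/-- **BC5 — the identity involution is a correspondence (PROVED)**: `φ = id` of `Hⁱ_B(X)` is
induced by the rational algebraic class of the diagonal (C-lite field `exists_isInducedBy_id`).
[cite: Kleiman1968, §1.3] -/
theorem isCorrespondence_id (B : BettiHodgeData ℂ) {n : ℕ} {X : SchemeOver ℂ}
    (hX : IsSmoothProjective n X) (i j' : ℕ) (hj : i + j' = 2 * n) :
    ∃ u ∈ B.W.ratAlgebraicClasses (X ⊗ X) n,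
      B.W.IsInducedBy n n u (HodgeStructure.Hom.id (B.hodge hX i)).toLinearMap hj
        (show i + 2 * n + j' = 2 * (n + n) by omega) := by
  obtain ⟨u, hu, h⟩ := B.W.exists_isInducedBy_id hX
  exact ⟨u, hu, h i j' hj⟩

end Summit.HodgeConjecture.HodgeConjecture.Cruxes.InvolutionsAreCorrespondences.Birth

end
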